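import Mathlib
import HarnessLib
import Literature.MathematicalPhysics.QuantumLattice.KohnLuttingerLindhardMeasurable

/-!
# Route `WeakCouplingBCS` — certificate half of stmt-HubbardSuperconductivity-0158, item «(E2)-TPRIME-LINDHARD-BOUND» (pen (R460)(A)):
# the level sets of the `t`–`t′` band are Lebesgue-null for every `|t′| < 1/2` — the fourth hypothesis `hlevel` of `klg_memLp_kernel_of_geometry`, UNCONDITIONALLY

Cell `gate-hubbard-kl`, seat p4 (g23); zero kit.  `t′`-twin of `Literature…volume_levelSet_squareDispersion` (`t′ = 0`): for `|t′| < 1/2` every slice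
`k₀ = x` of `{ε_{t′} = μ}` is `{y | cos y = −(μ + 2cos x)/(2 + 4t′cos x)}` (the coefficient `2 + 4t′cos x ≥ 2 − 4|t′| > 0` never vanishes), a countable
set (`countable_setOf_cos_eq`), so the level set is null by `Measure.measure_prod_null`.
* `kltp_volume_levelSet` — `volume {p | squareDispersion 1 t′ p = μ} = 0` for all `|t′| < 1/2`, all `μ`.
No definitions; nothing here asserts a record, a margin, `K₃`, `U₀`, the window or superconductivity.  [folklore]
-/

noncomputable section

-- the tree's namespace `Summit.<Summit>.<Problem>.Theorems` repeats the summit name by design (D-0017)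
set_option linter.dupNamespace false

namespace Summit.HubbardSuperconductivity.HubbardSuperconductivity.Theorems

open Real Set MeasureTheory MeasureTheory.Measure Literature.MathematicalPhysics.QuantumLattice

/-- **Level sets of the `t`–`t′` band are Lebesgue-null** (`|t′| < 1/2`, every `μ`): every slice `k₀ = const` is a level set of `cos`, hence countable. [folklore] -/
theorem kltp_volume_levelSet (tp : ℝ) (htp : |tp| < 1 / 2) (μ : ℝ) :
    volume {p : Momentum | squareDispersion 1 tp p = μ} = 0 := by
  set T : Set (ℝ × ℝ) := {x | -2 * 1 * (cos x.1 + cos x.2) - 4 * tp * cos x.1 * cos x.2 = μ} with hT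
  have hTmeas : MeasurableSet T := by
    refine (isClosed_eq ?_ continuous_const).measurableSet
    fun_prop
  have hpre : {p : Momentum | squareDispersion 1 tp p = μ} = (fun k : Momentum => ((k 0, k 1) : ℝ × ℝ)) ⁻¹' T := by
    ext p; simp [hT, squareDispersion]
  rw [hpre, measurePreserving_momentum_prod.measure_preimage hTmeas.nullMeasurableSet]
  rw [show (volume : Measure (ℝ × ℝ)) = (volume : Measure ℝ).prod volume from rfl, Measure.measure_prod_null hTmeas]
  refine Filter.Eventually.of_forall fun x => ?_
  -- the slice coefficient never vanishes: `2 + 4t′cos x ≥ 2 − 4|t′| > 0`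
  have hcoef : 0 < 2 + 4 * tp * cos x := by
    have h1 : |4 * tp * cos x| ≤ 4 * |tp| := by
      rw [abs_mul, abs_mul, abs_of_pos (by norm_num : (0 : ℝ) < 4)]
      exact mul_le_of_le_one_right (by positivity) (abs_cos_le_one x)
    have h2 : -(4 * |tp|) ≤ 4 * tp * cos x := (neg_le_neg h1).trans (neg_abs_le _)
    linarith
  have hslice : Prod.mk x ⁻¹' T = {y : ℝ | cos y = -(μ + 2 * cos x) / (2 + 4 * tp * cos x)} := by
    ext y
    simp only [hT, mem_preimage, mem_setOf_eq]
    rw [eq_div_iff hcoef.ne']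
    constructor <;> intro h <;> linarith
  simp only [Pi.zero_apply, hslice]
  exact (countable_setOf_cos_eq _).measure_zero volume

end Summit.HubbardSuperconductivity.HubbardSuperconductivity.Theorems

end
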